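import Literature.MathematicalPhysics.QuantumFieldTheory.Balaban1983to89.B2Ineq329RegularField
import Literature.MathematicalPhysics.QuantumFieldTheory.Balaban1983to89.B2Sect3BSmallFactors

/-!
# `Balaban1983to89.B2Ineq330RegularFieldConcrete` — [Balaban1982Higgs2] (3.30)–(3.31) p. 590, *"We use Proposition 3.1 and we
obtain (3.30) … (3.31)"*, AT A REGULAR NON-ZERO `Ã^ε` ON THE CONCRETE (3.23)/(3.24)/(3.25) CARRIER: r14's kernel lemmas
`B2Sect3BSmallFactors.ineq330`/`ineq331` FED with the concrete objects — `Z(Ã^ε)exp(−½⟨Φ,Δ(Ã^ε)Φ⟩) = F325 R C a Ã m² Φ`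
(p252464), Proposition 3.1 in its RESTRICTED (regular, non-zero field) form `B2Ineq329RegularField.prop31_regular_concrete`
(p305722) and the printed k-th covariant bond sums — so that the small factors `exp(−¼γ₀p(Lᵏε)²|Q| + O(·)|Λ_k|)` of (3.31) come
out of the concrete Gaussian (3.25) WITH the printed error term; the `Ã = 0` companion is p15's `B2Ineq330ZeroFieldConcrete`

statement-level skeleton of published theorems with citation tags; proofs where landed; nothing here is a claim about the Yang–Mills mass gap

CITATION HEADER.  T. Bałaban, *(Higgs)₂,₃ quantum fields in a finite volume. II. An upper bound*, Commun. Math. Phys. **86**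
(1982) 555–594 [Balaban1982Higgs2], (3.30)–(3.31) p. 590 (PDF held `paper:balaban1982-cmp86-higgs23-ii`; p. 590 [PDF 36] READ AS
IMAGE on the ×2 render `run/shared/lean/pub/pub-balaban/b2b-balaban-ref1/pages/1982-cmp86-higgs23-II/1982-cmp86-higgs23-II-p036-x2.png`).
Cell `lit-balaban` (HOME `run/shared/lean/pub/lit-balaban/`), Phase-2 proof seat **p23** gen 9 (unit `lit-balaban-p23-g9`), second
target of the gen.  SKELETON row **B2.Eq3.32** (members (3.30), (3.31); owner r02, second reader r14, referee ref-4; decls of record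
r14's `B2Sect3BSmallFactors.ineq330`, `ineq331`, `ineq331_printed` — USED BY NAME here, not restated); companion rows B2.Prop3.1 /
B2.Eq3.29 (the restricted clause `B2Ineq329RegularField.prop31_regular_concrete`, `ineq329_regular_concrete`, p305722).

WHAT IS PRINTED (p. 590): *"We use Proposition 3.1 and we obtain Z(Ã^ε)exp(−½⟨Φ, Δ(Ã^ε)Φ⟩) ≤ Z(Ã^ε)exp(−¼⟨Φ, Δ(Ã^ε)Φ⟩)
·exp(−¼(the right side of (3.26))). (3.30)  Now we estimate the characteristic functions by 1, except the functions ζ_{Λ₀⁽ᵏ⁾}.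
These contain the functions χ^c_{Q_s⁽ᵏ⁾}, which give the restrictions of the form (Lᵏε)^{d−2}|U(Ã^ε(⟨x,x′⟩))φ_k(x′) − φ_k(x)|²
> p(Lᵏε)² for all the bonds ⟨x,x′⟩ ∈ Q_s⁽ᵏ⁾. The bonds of this set are contained in Λ₇⁽ᵏ⁻¹⁾′∩Λ₀⁽ᵏ⁾ᶜ ⊂ Λ₅⁽ᵏ⁻¹⁾′∩Λ₅⁽ᵏ⁾ᶜ, hence
χ^c_{Q_s⁽ᵏ⁾} exp(−¼(kᵗʰ term of the right side of (3.26))) ≤ exp(−¼γ₀p(Lᵏε)²|Q_s⁽ᵏ⁾| + O((Lᵏε)^{κ₀})|Λ_k|). (3.31)"*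

DICTIONARY.  "the right side of (3.26)" (restricted clause) ↦ `γ₀(bond₀ + Σ_k bondKA_k) + γ₀(mass₀ + Σ_k massK_k) − Σ_k err_k`
with `bondKA_k = Σ_{c⊂Λ_k}(Lᵏε)^d|(D^{Lᵏε}_{Ā⁽ᵏ⁾}φ̃_k)(c)|²` (= the printed `Σ(Lᵏε)^{d−2}|U(Ã(⟨x,x′⟩))φ_k(x′) − φ_k(x)|²`,
`B2Ineq329RegularField.bondKA_eq_sum_printed`; the coarse bond variable is `Lᵏε·Ā⁽ᵏ⁾ = ε·Σ_{straight}Ã`, (II.2.55)) and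
`err_k = 64γ₀d³e²(Lᵏδ_k)²Ψ_k²(Lᵏε)^d|Λ_k|` (the `O(·)|Λ_k|` of `prop31_regular_concrete` under the sup-restrictions
`|φ_k| ≤ Ψ_k` and the `δ_k`-regularity of `Ã` on `Bᵏ(Λ_k)`); "kᵗʰ term of the right side of (3.26)" ↦ `γ₀(bondKA_k + massK_k) − E`
with `E` that error; `U(Ã^ε(⟨x,x′⟩))` for a coarse bond ↦ `C.U (P.mesh 0) (segSum Ã (toFinest c.src) c.dir (Lᵏ))` (= `U(Lᵏε, Ā⁽ᵏ⁾(c))`,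
`U_mesh_barA`); `p(Lᵏε)²` ↦ any real `Pv`; `χ^c_Q` ↦ `χ ∈ {0,1}` with the restriction assumed when `χ = 1`.

WHAT THIS MODULE PROVES (kernel-checked, 0 `sorry`, no definition, standard axioms).  **`ineq330_regular_concrete`** — (3.30) for the
concrete `F325`, `Z325`, `form325` at a regular `Ã ≠ 0` and every restricted `Φ`; **`bondKA_ge_of_large`** (if every bond of
`Q ⊂ {bonds ⊂ Λ_k}` carries `(Lᵏε)^{d−2}|U(Ã(⟨x,x′⟩))ψ(x′) − ψ(x)|² > Pv` then `Pv·|Q| ≤ bondKA`); **`ineq331_regular_concrete`** —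
(3.31) WITH its error term: `χ·exp(−¼(γ₀(bondKA + massK) − E)) ≤ exp(−¼γ₀Pv|Q| + ¼E)` (`χ ∈ {0,1}`), and the printed weaker form
`… ≤ exp(−¼γ₀Pv|Q| + E)` for `E ≥ 0` (`ineq331_regular_concrete_printed`); `ineq331_regular_concrete_sup` displays `E` as the
explicit `O(·)|Λ_k|` of the restricted Prop. 3.1.
HONEST SCOPE.  The sets `Q_s⁽ᵏ⁾` and the characteristic functions (3.21) are not constructed: `Q` is any set of bonds inside `Λ_k`,
the large-gradient restriction is the hypothesis `hlarge`, the regularity of `Ã` and the sup-restrictions on `Φ` are hypotheses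
(as in `B2Ineq329RegularField`); `Pv` is any real (the print: `p(Lᵏε)²`); the identification of `E` with `O((Lᵏε)^{κ₀})|Λ_k|` is
b2b's dictionary `B2.ineq329_of_prop31Printed` (pub-balaban GAPS G-pv07-1 (ii)), not repeated.
-/

noncomputable section

open MeasureTheory Finset Real
open scoped BigOperators ENNReal InnerProductSpace

namespace Literature.MathematicalPhysics.QuantumFieldTheory.Balaban1983to89.B2Ineq330RegularFieldConcrete

open Literature.MathematicalPhysics.QuantumFieldTheory.Balaban1983to89.HiggsLattice
open Literature.MathematicalPhysics.QuantumFieldTheory.Balaban1983to89.HiggsAveraging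
open Literature.MathematicalPhysics.QuantumFieldTheory.Balaban1983to89.HiggsCovariance
open Literature.MathematicalPhysics.QuantumFieldTheory.Balaban1983to89.HiggsCovariancePos
open Literature.MathematicalPhysics.QuantumFieldTheory.Balaban1983to89.B2Eq337ScalarIntegration
open Literature.MathematicalPhysics.QuantumFieldTheory.Balaban1983to89.B2Eq325ConcreteSchur
open Literature.MathematicalPhysics.QuantumFieldTheory.Balaban1983to89.B2Ineq327ConcreteNeumann
open Literature.MathematicalPhysics.QuantumFieldTheory.Balaban1983to89.B2Eq328ConcretePieces
open Literature.MathematicalPhysics.QuantumFieldTheory.Balaban1983to89.B2Eq328DeltaK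
open Literature.MathematicalPhysics.QuantumFieldTheory.Balaban1983to89.B2Prop31ZeroFieldConcrete
open Literature.MathematicalPhysics.QuantumFieldTheory.Balaban1983to89.B2Sect3BSmallFactors
open Literature.MathematicalPhysics.QuantumFieldTheory.Balaban1983to89.B2Eq255Concrete (barA)
open Literature.MathematicalPhysics.QuantumFieldTheory.Balaban1983to89.B2Ineq329RegularField

variable {P : HiggsLattice.Params} {N K : ℕ}

section Ineq330

variable (R : Regions P K) (C : ChargeData N) {a msq : ℝ}

/-- **(3.30) AT A REGULAR `Ã^ε ≠ 0` ON THE CONCRETE CARRIER**: for nested region data, `Ã` `δ_k`-regular on each `Bᵏ(Λ_k)` with the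
smallness of `B2Ineq329RegularField`, an admissible `γ₀`, and every configuration `Φ` of (3.24) obeying the sup-restrictions
`|φ_k| ≤ Ψ_k` on `Λ_k`:
`Z(Ã)exp(−½⟨Φ,Δ(Ã)Φ⟩) ≤ Z(Ã)exp(−¼⟨Φ,Δ(Ã)Φ⟩)·exp(−¼·(γ₀(bond₀ + Σ_k bondKA_k) + γ₀(mass₀ + Σ_k massK_k) − Σ_k err_k))` — r14's
kernel `ineq330` fed with `F325 = Z325·exp(−½ form325)` (`eq325_concrete`), `Z325 > 0` and Proposition 3.1 in the restricted form
`prop31_regular_concrete`. [cite: Balaban1982Higgs2, (3.30) p.590] -/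
theorem ineq330_regular_concrete (A : HiggsLattice.VecField P 0) (hR : Nested R) (hK : K ≤ P.K) (hε : P.mesh K ≤ 1)
    (ha : 0 < a) (hL : 1 < P.L) (hmsq : 0 < msq) {δ : Fin K → ℝ} (hδ : ∀ j, 0 ≤ δ j)
    (hreg : ∀ (j : Fin K), ∀ z ∈ pieceF R j, ∀ μ' ν : Fin P.d, |A ⟨z.shift ν, μ'⟩ - A ⟨z, μ'⟩| ≤ δ j)
    (hsmall : ∀ j : Fin K, 8 * (P.d : ℝ) ^ 4 * (P.L : ℝ) ^ P.d * C.e ^ 2 * P.mesh (j.val + 1) ^ 2 *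
      ((P.L : ℝ) ^ (j.val + 1)) ^ 2 * δ j ^ 2 ≤ 1 / 2)
    {γ₀ : ℝ} (hγ0 : 0 ≤ γ₀) (hγB : γ₀ * (8 * P.d + 2 * msq + 4) ≤ a * (1 - ((P.L : ℝ) ^ 2)⁻¹))
    (hγ16 : γ₀ ≤ 1 / 16) (Ψ : Fin K → ℝ) (Φ : Cfg R N) (hΦ : ∀ (j : Fin K) (y : LSite R j), ‖resL R j Φ y‖ ≤ Ψ j) :
    F325 R C a A msq Φ
      ≤ Z325 R C a A msq * Real.exp (-(form325 R C a A msq Φ / 4))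
          * Real.exp (-((γ₀ * (bond0 R C A Φ.1 + ∑ j : Fin K, (∑ c : HiggsLattice.PBond P (j.val + 1),
                if Inside (R.block j) c then P.mesh (j.val + 1) ^ P.d *
                  ‖covDeriv C (barA (j.val + 1) A) (extL R j (resL R j Φ)) c‖ ^ 2 else 0))
              + γ₀ * (mass0 R msq Φ.1 + ∑ j : Fin K, massK R msq j (resL R j Φ))
              - ∑ j : Fin K, 64 * γ₀ * (P.d : ℝ) ^ 3 * C.e ^ 2 * ((P.L : ℝ) ^ (j.val + 1)) ^ 2 * δ j ^ 2 *
                  (Ψ j ^ 2 * P.mesh (j.val + 1) ^ P.d * ((R.block j).card : ℝ))) / 4)) := by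
  rw [eq325_concrete R C A ha hL hmsq Φ]
  have e : Real.exp (-(1/2 : ℝ) * form325 R C a A msq Φ) = Real.exp (-(form325 R C a A msq Φ / 2)) := by
    congr 1
    ring
  rw [e]
  exact ineq330 (Z325_pos R C A ha hL hmsq).le
    (prop31_regular_concrete R C A hR hK hε ha hL hmsq hδ hreg hsmall hγ0 hγB hγ16 Ψ Φ hΦ)

end Ineq330

section Ineq331

variable (R : Regions P K) (C : ChargeData N) {a msq : ℝ}

/-- **The covariant large-gradient restriction feeds the covariant bond sum**: if every bond `⟨x,x′⟩` of a set `Q` of bonds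
inside `Λ_k` carries `(Lᵏε)^{d−2}|U(Ã(⟨x,x′⟩))ψ(x′) − ψ(x)|² > Pv` (the restriction given by `χ^c_{Q_s⁽ᵏ⁾}`, p. 590; the coarse
transport `U(Ã(⟨x,x′⟩)) = U(ε, Σ_{straight}Ã) = U(Lᵏε, Ā⁽ᵏ⁾)`), then `Pv·|Q| ≤ Σ_{c⊂Λ_k}(Lᵏε)^d|(D_{Ā⁽ᵏ⁾}ψ̃)(c)|²`.
[cite: Balaban1982Higgs2, (3.31) p.590] -/
theorem bondKA_ge_of_large (A : HiggsLattice.VecField P 0) (j : Fin K) (ψ : LSite R j → V N)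
    (Q : Finset (HiggsLattice.PBond P (j.val + 1))) (hQ : ∀ c ∈ Q, Inside (R.block j) c) (Pv : ℝ)
    (hlarge : ∀ c ∈ Q, Pv < P.mesh (j.val + 1) ^ P.d * (P.mesh (j.val + 1))⁻¹ ^ 2 *
      ‖C.U (P.mesh 0) (segSum A (toFinest c.src) c.dir (P.L ^ (j.val + 1))) (extL R j ψ c.tgt) - extL R j ψ c.src‖ ^ 2) :
    Pv * Q.card ≤ ∑ c : HiggsLattice.PBond P (j.val + 1), if Inside (R.block j) c then
      P.mesh (j.val + 1) ^ P.d * ‖covDeriv C (barA (j.val + 1) A) (extL R j ψ) c‖ ^ 2 else 0 := by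
  classical
  rw [bondKA_eq_sum_printed, ← Finset.sum_filter]
  have hsub : Q ⊆ Finset.univ.filter (fun c : HiggsLattice.PBond P (j.val + 1) => Inside (R.block j) c) := fun c hc =>
    Finset.mem_filter.2 ⟨Finset.mem_univ _, hQ c hc⟩
  calc Pv * Q.card = ∑ _c ∈ Q, Pv := by rw [Finset.sum_const, nsmul_eq_mul, mul_comm]
    _ ≤ ∑ c ∈ Q, P.mesh (j.val + 1) ^ P.d * (P.mesh (j.val + 1))⁻¹ ^ 2 *
          ‖C.U (P.mesh 0) (segSum A (toFinest c.src) c.dir (P.L ^ (j.val + 1))) (extL R j ψ c.tgt) - extL R j ψ c.src‖ ^ 2 :=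
        Finset.sum_le_sum fun c hc => (hlarge c hc).le
    _ ≤ _ := Finset.sum_le_sum_of_subset_of_nonneg hsub fun c _ _ =>
        mul_nonneg (mul_nonneg (pow_nonneg (P.mesh_pos _).le _) (sq_nonneg _)) (sq_nonneg _)

/-- **(3.31) AT A REGULAR `Ã^ε ≠ 0` ON THE CONCRETE CARRIER, WITH ITS ERROR TERM**: under the covariant large-gradient restriction on
the bonds of `Q ⊂ {bonds ⊂ Λ_k}` (active when `χ = χ^c_Q = 1`), for every error `E` carried by the kᵗʰ term of (3.26),
`χ·exp(−¼(γ₀(bondKA + massK) − E)) ≤ exp(−¼γ₀Pv|Q| + ¼E)` (`γ₀ ≥ 0`, `m² ≥ 0`, `χ ∈ {0,1}`) — r14's kernel `ineq331` shape.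
[cite: Balaban1982Higgs2, (3.31) p.590] -/
theorem ineq331_regular_concrete (A : HiggsLattice.VecField P 0) (hmsq : 0 ≤ msq) {γ₀ : ℝ} (hγ : 0 ≤ γ₀) (j : Fin K)
    (ψ : LSite R j → V N) (Q : Finset (HiggsLattice.PBond P (j.val + 1))) (hQ : ∀ c ∈ Q, Inside (R.block j) c) (Pv E : ℝ)
    {χ : ℝ} (hχ : χ = 0 ∨ χ = 1)
    (hlarge : χ = 1 → ∀ c ∈ Q, Pv < P.mesh (j.val + 1) ^ P.d * (P.mesh (j.val + 1))⁻¹ ^ 2 *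
      ‖C.U (P.mesh 0) (segSum A (toFinest c.src) c.dir (P.L ^ (j.val + 1))) (extL R j ψ c.tgt) - extL R j ψ c.src‖ ^ 2) :
    χ * Real.exp (-((γ₀ * ((∑ c : HiggsLattice.PBond P (j.val + 1), if Inside (R.block j) c then
        P.mesh (j.val + 1) ^ P.d * ‖covDeriv C (barA (j.val + 1) A) (extL R j ψ) c‖ ^ 2 else 0) + massK R msq j ψ) - E) / 4))
      ≤ Real.exp (-(γ₀ * Pv * Q.card / 4) + E / 4) := by
  rcases hχ with h0 | h1
  · rw [h0, zero_mul]
    exact (Real.exp_pos _).le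
  · rw [h1, one_mul]
    refine Real.exp_le_exp.2 ?_
    have hb := bondKA_ge_of_large R C A j ψ Q hQ Pv (hlarge h1)
    have hm := massK_nonneg R hmsq j ψ
    have h3 : γ₀ * (Pv * Q.card) ≤ γ₀ * ((∑ c : HiggsLattice.PBond P (j.val + 1), if Inside (R.block j) c then
        P.mesh (j.val + 1) ^ P.d * ‖covDeriv C (barA (j.val + 1) A) (extL R j ψ) c‖ ^ 2 else 0) + massK R msq j ψ) :=
      mul_le_mul_of_nonneg_left (by linarith) hγ
    linarith

/-- (3.31) in the printed weaker form `… ≤ exp(−¼γ₀Pv|Q| + E)` for `E ≥ 0` (the print writes `+ O((Lᵏε)^{κ₀})|Λ_k|` without the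
factor ¼; r14's `ineq331_printed` shape). [cite: Balaban1982Higgs2, (3.31) p.590] -/
theorem ineq331_regular_concrete_printed (A : HiggsLattice.VecField P 0) (hmsq : 0 ≤ msq) {γ₀ : ℝ} (hγ : 0 ≤ γ₀) (j : Fin K)
    (ψ : LSite R j → V N) (Q : Finset (HiggsLattice.PBond P (j.val + 1))) (hQ : ∀ c ∈ Q, Inside (R.block j) c) (Pv : ℝ)
    {E : ℝ} (hE : 0 ≤ E) {χ : ℝ} (hχ : χ = 0 ∨ χ = 1)
    (hlarge : χ = 1 → ∀ c ∈ Q, Pv < P.mesh (j.val + 1) ^ P.d * (P.mesh (j.val + 1))⁻¹ ^ 2 *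
      ‖C.U (P.mesh 0) (segSum A (toFinest c.src) c.dir (P.L ^ (j.val + 1))) (extL R j ψ c.tgt) - extL R j ψ c.src‖ ^ 2) :
    χ * Real.exp (-((γ₀ * ((∑ c : HiggsLattice.PBond P (j.val + 1), if Inside (R.block j) c then
        P.mesh (j.val + 1) ^ P.d * ‖covDeriv C (barA (j.val + 1) A) (extL R j ψ) c‖ ^ 2 else 0) + massK R msq j ψ) - E) / 4))
      ≤ Real.exp (-(γ₀ * Pv * Q.card / 4) + E) :=
  (ineq331_regular_concrete R C A hmsq hγ j ψ Q hQ Pv E hχ hlarge).trans (Real.exp_le_exp.2 (by linarith))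

/-- **(3.31) with the error displayed as the `O(·)|Λ_k|` of the restricted Proposition 3.1**: for a piece `φ_k↾Λ_k` obeying the
sup-restriction `|φ_k| ≤ Ψ` (and `Ã` `δ`-regular on `Bᵏ(Λ_k)` in `prop31_regular_concrete`), the kᵗʰ error is
`E = 64γ₀d³e²(Lᵏδ)²Ψ²(Lᵏε)^d|Λ_k|`, and (3.31) reads `χ^c_Q·exp(−¼(kᵗʰ term)) ≤ exp(−¼γ₀Pv|Q| + ¼E)`.
[cite: Balaban1982Higgs2, (3.31) p.590] -/
theorem ineq331_regular_concrete_sup (A : HiggsLattice.VecField P 0) (hmsq : 0 ≤ msq) {γ₀ : ℝ} (hγ : 0 ≤ γ₀) (j : Fin K)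
    (ψ : LSite R j → V N) (Q : Finset (HiggsLattice.PBond P (j.val + 1))) (hQ : ∀ c ∈ Q, Inside (R.block j) c) (Pv δ Ψ : ℝ)
    {χ : ℝ} (hχ : χ = 0 ∨ χ = 1)
    (hlarge : χ = 1 → ∀ c ∈ Q, Pv < P.mesh (j.val + 1) ^ P.d * (P.mesh (j.val + 1))⁻¹ ^ 2 *
      ‖C.U (P.mesh 0) (segSum A (toFinest c.src) c.dir (P.L ^ (j.val + 1))) (extL R j ψ c.tgt) - extL R j ψ c.src‖ ^ 2) :
    χ * Real.exp (-((γ₀ * ((∑ c : HiggsLattice.PBond P (j.val + 1), if Inside (R.block j) c then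
        P.mesh (j.val + 1) ^ P.d * ‖covDeriv C (barA (j.val + 1) A) (extL R j ψ) c‖ ^ 2 else 0) + massK R msq j ψ)
        - 64 * γ₀ * (P.d : ℝ) ^ 3 * C.e ^ 2 * ((P.L : ℝ) ^ (j.val + 1)) ^ 2 * δ ^ 2 *
            (Ψ ^ 2 * P.mesh (j.val + 1) ^ P.d * ((R.block j).card : ℝ))) / 4))
      ≤ Real.exp (-(γ₀ * Pv * Q.card / 4)
          + 64 * γ₀ * (P.d : ℝ) ^ 3 * C.e ^ 2 * ((P.L : ℝ) ^ (j.val + 1)) ^ 2 * δ ^ 2 *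
            (Ψ ^ 2 * P.mesh (j.val + 1) ^ P.d * ((R.block j).card : ℝ)) / 4) :=
  ineq331_regular_concrete R C A hmsq hγ j ψ Q hQ Pv _ hχ hlarge

end Ineq331

end Literature.MathematicalPhysics.QuantumFieldTheory.Balaban1983to89.B2Ineq330RegularFieldConcrete
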